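import Literature.IUT.HodgeTheaters.GlobalFrobenioidsRealifyProofs
import Literature.AlgebraicGeometry.Frobenioids.MonoidRealification
import Mathlib.Algebra.BigOperators.Pi
import HarnessLib

/-!
# [IUTchI] Example 3.5 (i) ↔ [FrdI] Def 2.4 (i): `Φ_{𝒞⊩_mod}` with the realification map has the UNIVERSAL PROPERTY
# of the realification `Φ(F_mod)^rlf` for `ℝ_{≥0}`-valued degrees (PROOF-ONLY)

Mochizuki, *Inter-universal Teichmüller theory I*, §3, Example 3.5 (i), kurims manuscript (May 2020) p. 84
([IUTchI] Ex 3.5 (i) p.84) [claim: Mochizuki2012, status: disputed]: `𝒞⊩_mod` is "the realification of the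
Frobenioid … of arithmetic line bundles on `S_mod`", "`Φ_{𝒞⊩_mod,v} ≅ ord(𝒪^▷_{(F_mod)_v})^pf ⊗ ℝ_{≥0}`"; and
Mochizuki, *The geometry of Frobenioids I*, Kyushu J. Math. **62** (2008), Def 2.4 (i) p. 48 (the realification
`M^rlf`), Thm 6.4 (i) p. 115 ("the homomorphism `(Φ^rlf)^gp(L) = ArithDiv_ℝ(L) → ℝ` given by `deg_L^arith`").

PROOF-ONLY (abc-iut-w4-d050; L5-lead RULINGS #26 (2) GO: «t2's `PhiMod` = L1's intrinsic `IsPerfFactorial.Rlf` of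
`EffArithDivisor`»).  abc-iut-L1 characterises THE realification `Φ(L)^rlf` by the universal property
`IsPerfFactorial.Rlf.existsUnique_hom_extending` (`RealificationDegreeExtension.lean`): every `ℝ_{≥0}`-valued degree
`d : Φ(L) → ℝ_{≥0}` extends UNIQUELY along `ι : Φ(L) → Φ(L)^rlf` (and the extension is `ℝ_{≥0}`-linear).  THIS FILE
proves that abc-iut-L5-t2's `Φ_{𝒞⊩_mod} = (V(L) →₀ ℝ_{≥0})` together with the realification map
`EffArithDivisor.realifyMod L : Φ(L) → Φ_{𝒞⊩_mod}` (`GlobalFrobenioidsRealify.lean`, t2's `log⊢_mod(p_v) ↦ 1`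
coordinates) has THE SAME universal property:

* `realifyMod_existsUnique_extension` — for every additive `d : EffArithDivisor L →+ ℝ_{≥0}` there is a UNIQUE
  additive `δ : (Val L →₀ ℝ_{≥0}) →+ ℝ_{≥0}` with `δ ∘ realifyMod = d` (multiplicative rendering, as in abc-iut-L1:
  `realifyMod_existsUnique_monoidHom_extension`); the extension is automatically `ℝ_{≥0}`-linear on coordinate rays
  (additive self-maps of `ℝ_{≥0}` are homotheties, abc-iut-L1's `addMonoidHom_nnreal_apply`) and takes the value
  `e_v · d([v])` on the unit vector at a finite `v` (`realifyExtension_single_inr`) and `d(1_w)` at an archimedean `w`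
  (`realifyExtension_single_inl`);
* `realifyMod_extension_unique` — two additive maps out of `Φ_{𝒞⊩_mod}` that agree after `realifyMod` are equal
  (`Φ_{𝒞⊩_mod}` is `ℝ_{≥0}`-generated by the image, cf. `phiMod_eq_sum_smul_realifyMod`).

Thus `(Φ_{𝒞⊩_mod}, realifyMod)` and `(Φ(L)^rlf, ι)` corepresent the same functor of `ℝ_{≥0}`-valued degrees on
`Φ(L)` — the kernel form of "`𝒞⊩_mod` = the realification of `†ℱ^⊛_mod`" at the divisor-monoid level.  NOT done here:
an explicit monoid isomorphism `Φ(L)^rlf ≃* Φ_{𝒞⊩_mod}` under `Φ(L)` (it needs the prime-by-prime structure of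
`M^rlf`, abc-iut-L1's `DirectSum.realification_eq_directSum`; the residual after-merge item).  No definitions; no new
Prop fact; no statement of the paper is strengthened; no side is taken on [IUTchIII] Cor. 3.12.
-/

noncomputable section

open scoped Classical NNReal

namespace Literature.IUT.HodgeTheaters

open NumberField Literature.AlgebraicGeometry.Frobenioids

variable (L : Type) [Field L] [NumberField L]

/-! ### Additive maps out of `Φ(L)` and out of `Φ_{𝒞⊩_mod}`: values on generators -/

/-- An additive `d` on the archimedean part is `ℝ_{≥0}`-linear in each coordinate: `d(0, x·1_w) = d(0, 1_w) · x`
(additive self-maps of `ℝ_{≥0}` are homotheties). ([IUTchI] Ex 3.5 (i) p.84) [claim: Mochizuki2012, status: disputed] -/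
theorem degree_arch_single (d : EffArithDivisor L →+ ℝ≥0) (w : InfinitePlace L) (x : ℝ≥0) :
    d (0, Pi.single w x) = d (0, Pi.single w 1) * x := by
  let f : ℝ≥0 →+ ℝ≥0 :=
    { toFun := fun t => d (0, Pi.single w t)
      map_zero' := by rw [Pi.single_zero]; exact d.map_zero
      map_add' := fun s t => by
        rw [← d.map_add, Prod.mk_add_mk, add_zero, Pi.single_add] }
  exact addMonoidHom_nnreal_apply f x

/-- An additive `d` on the finite part: `d(n · [v], 0) = n · d([v], 0)`.
([IUTchI] Ex 3.5 (i) p.84) [claim: Mochizuki2012, status: disputed] -/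
theorem degree_fin_single (d : EffArithDivisor L →+ ℝ≥0) (v : FinitePlace L) (n : ℕ) :
    d (Finsupp.single v n, 0) = n • d (Finsupp.single v 1, 0) := by
  rw [← map_nsmul, Prod.smul_mk, smul_zero, Finsupp.smul_single, smul_eq_mul, mul_one]

/-- An additive map out of `Φ_{𝒞⊩_mod} = (V(L) →₀ ℝ_{≥0})` is `ℝ_{≥0}`-linear on each coordinate ray:
`δ(x · 1_v) = δ(1_v) · x`. ([IUTchI] Ex 3.5 (i) p.84) [claim: Mochizuki2012, status: disputed] -/
theorem phiMod_hom_single (δ : (Val L →₀ ℝ≥0) →+ ℝ≥0) (v : Val L) (x : ℝ≥0) :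
    δ (Finsupp.single v x) = δ (Finsupp.single v 1) * x :=
  addMonoidHom_nnreal_apply (δ.comp (Finsupp.singleAddHom v)) x

/-! ### The extension of a degree along `realifyMod` -/

/-- **Uniqueness**: two additive maps `Φ_{𝒞⊩_mod} → ℝ_{≥0}` that agree after composition with `realifyMod` are equal
— the image of `Φ(L)` generates `Φ_{𝒞⊩_mod}` over `ℝ_{≥0}` (unit vectors are `e_v ·` resp. `1 ·` images).
([IUTchI] Ex 3.5 (i) p.84) [claim: Mochizuki2012, status: disputed] -/
theorem realifyMod_extension_unique {δ₁ δ₂ : (Val L →₀ ℝ≥0) →+ ℝ≥0}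
    (h : δ₁.comp (EffArithDivisor.realifyMod L) = δ₂.comp (EffArithDivisor.realifyMod L)) : δ₁ = δ₂ := by
  have hgen : ∀ (x : EffArithDivisor L), δ₁ (EffArithDivisor.realifyMod L x) = δ₂ (EffArithDivisor.realifyMod L x) :=
    fun x => DFunLike.congr_fun h x
  refine Finsupp.addHom_ext fun v x => ?_
  rw [phiMod_hom_single L δ₁, phiMod_hom_single L δ₂]
  congr 1
  rcases v with w | w
  · -- archimedean: `1_w = realifyMod (0, 1_w)`
    have := hgen (0, Pi.single w 1)
    rwa [realifyMod_arch_single] at this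
  · -- finite: `1_w = realifyMod (e_w · [w], 0)`
    have := hgen (Finsupp.single w (absRamIdx L w), 0)
    rwa [realifyMod_single_absRamIdx] at this

/-- **Existence, with the values on unit vectors**: an additive `δ : Φ_{𝒞⊩_mod} → ℝ_{≥0}` with `δ ∘ realifyMod = d`,
`δ(1_v) = e_v · d([v])` (finite `v`), `δ(1_w) = d(1_w)` (archimedean `w`).
([IUTchI] Ex 3.5 (i) p.84) [claim: Mochizuki2012, status: disputed] -/
theorem realifyMod_exists_extension (d : EffArithDivisor L →+ ℝ≥0) :
    ∃ δ : (Val L →₀ ℝ≥0) →+ ℝ≥0, δ.comp (EffArithDivisor.realifyMod L) = d ∧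
      (∀ v : FinitePlace L, δ (@Finsupp.single (Val L) ℝ≥0 _ (Sum.inr v) 1) =
          (absRamIdx L v : ℝ≥0) * d (Finsupp.single v 1, 0)) ∧
      (∀ w : InfinitePlace L, δ (@Finsupp.single (Val L) ℝ≥0 _ (Sum.inl w) 1) = d (0, Pi.single w 1)) := by
  -- the coefficient of the extension at each place
  let c : Val L → ℝ≥0 := fun v => match v with
    | Sum.inl w => d (0, Pi.single w 1)
    | Sum.inr w => (absRamIdx L w : ℝ≥0) * d (Finsupp.single w 1, 0)
  let δ : (Val L →₀ ℝ≥0) →+ ℝ≥0 := Finsupp.liftAddHom fun v => AddMonoidHom.mulLeft (c v)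
  have hδ : ∀ (v : Val L) (x : ℝ≥0), δ (Finsupp.single v x) = c v * x := fun v x => by
    simp only [δ, Finsupp.liftAddHom_apply_single]
    rfl
  have hcl : ∀ w : InfinitePlace L, c (Sum.inl w) = d (0, Pi.single w 1) := fun _ => rfl
  have hcr : ∀ w : FinitePlace L, c (Sum.inr w) = (absRamIdx L w : ℝ≥0) * d (Finsupp.single w 1, 0) :=
    fun _ => rfl
  -- finite part
  have hfin : ∀ f : FinitePlace L →₀ ℕ, δ (EffArithDivisor.realifyMod L (f, 0)) = d (f, 0) := by
    intro f
    induction f using Finsupp.induction with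
    | zero =>
      change δ (EffArithDivisor.realifyMod L 0) = d 0
      rw [map_zero, map_zero, map_zero]
    | single_add v n f _ _ ih =>
      have hadd : ((Finsupp.single v n + f, 0) : EffArithDivisor L) = (Finsupp.single v n, 0) + (f, 0) := by
        rw [Prod.mk_add_mk, add_zero]
      rw [hadd, map_add, map_add, map_add, ih]
      congr 1
      have hsingle : ((Finsupp.single v n, 0) : EffArithDivisor L) = n • (Finsupp.single v 1, 0) := by
        rw [Prod.smul_mk, smul_zero, Finsupp.smul_single, smul_eq_mul, mul_one]
      rw [hsingle, map_nsmul, map_nsmul, map_nsmul, realifyMod_single_one, hδ, hcr,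
        mul_right_comm, mul_inv_cancel₀ (absRamIdx_cast_ne_zero L v), one_mul]
  -- archimedean part
  have harc : ∀ g : InfinitePlace L → ℝ≥0, δ (EffArithDivisor.realifyMod L (0, g)) = d (0, g) := by
    intro g
    induction g using Pi.single_induction with
    | zero =>
      change δ (EffArithDivisor.realifyMod L 0) = d 0
      rw [map_zero, map_zero, map_zero]
    | add g g' hg hg' =>
      have hadd : ((0, g + g') : EffArithDivisor L) = (0, g) + (0, g') := by
        rw [Prod.mk_add_mk, add_zero]
      rw [hadd, map_add, map_add, map_add, hg, hg']
    | single w x =>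
      rw [realifyMod_arch_single, hδ, hcl, degree_arch_single L d w x]
  refine ⟨δ, ?_, fun v => ?_, fun w => ?_⟩
  · refine AddMonoidHom.ext fun x => ?_
    obtain ⟨f, g⟩ := x
    have hsplit : ((f, g) : EffArithDivisor L) = (f, 0) + (0, g) := by
      rw [Prod.mk_add_mk, add_zero, zero_add]
    rw [AddMonoidHom.comp_apply, hsplit, map_add, map_add, map_add, hfin, harc]
  · rw [hδ, mul_one]
  · rw [hδ, mul_one]

/-- **[IUTchI] Ex 3.5 (i) ↔ [FrdI] Def 2.4 (i) — `(Φ_{𝒞⊩_mod}, realifyMod)` has the universal property of the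
realification for `ℝ_{≥0}`-valued degrees**: every additive `d : Φ(L) → ℝ_{≥0}` factors UNIQUELY through
`realifyMod : Φ(L) → Φ_{𝒞⊩_mod}` — the same universal property by which abc-iut-L1 characterises
`Φ(L)^rlf` (`IsPerfFactorial.Rlf.existsUnique_hom_extending`).  ([IUTchI] Ex 3.5 (i) p.84)
[claim: Mochizuki2012, status: disputed] -/
theorem realifyMod_existsUnique_extension (d : EffArithDivisor L →+ ℝ≥0) :
    ∃! δ : (Val L →₀ ℝ≥0) →+ ℝ≥0, δ.comp (EffArithDivisor.realifyMod L) = d := by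
  obtain ⟨δ, hδ, -, -⟩ := realifyMod_exists_extension L d
  exact ⟨δ, hδ, fun δ' hδ' => realifyMod_extension_unique L (hδ'.trans hδ.symm)⟩

/-- The values of THE extension on unit vectors at finite places: `δ(1_v) = e_v · d([v])`.
([IUTchI] Ex 3.5 (i) p.84) [claim: Mochizuki2012, status: disputed] -/
theorem realifyExtension_single_inr (d : EffArithDivisor L →+ ℝ≥0) (δ : (Val L →₀ ℝ≥0) →+ ℝ≥0)
    (hδ : δ.comp (EffArithDivisor.realifyMod L) = d) (v : FinitePlace L) :
    δ (@Finsupp.single (Val L) ℝ≥0 _ (Sum.inr v) 1) = (absRamIdx L v : ℝ≥0) * d (Finsupp.single v 1, 0) := by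
  obtain ⟨δ₀, hδ₀, hfin, -⟩ := realifyMod_exists_extension L d
  rw [realifyMod_extension_unique L (hδ.trans hδ₀.symm)]
  exact hfin v

/-- … and at archimedean places: `δ(1_w) = d(1_w)` (any `DecidableEq` instance on the infinite places).
([IUTchI] Ex 3.5 (i) p.84) [claim: Mochizuki2012, status: disputed] -/
theorem realifyExtension_single_inl (d : EffArithDivisor L →+ ℝ≥0) (δ : (Val L →₀ ℝ≥0) →+ ℝ≥0)
    (hδ : δ.comp (EffArithDivisor.realifyMod L) = d) (w : InfinitePlace L) :
    δ (@Finsupp.single (Val L) ℝ≥0 _ (Sum.inl w) 1) = d (0, Pi.single w 1) := by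
  obtain ⟨δ₀, hδ₀, -, harc⟩ := realifyMod_exists_extension L d
  rw [realifyMod_extension_unique L (hδ.trans hδ₀.symm)]
  exact harc w

/-- **The multiplicative rendering used by abc-iut-L1** (`M →* Multiplicative ℝ≥0`): every monoid homomorphism
`Multiplicative (EffArithDivisor L) →* Multiplicative ℝ≥0` (an `ℝ_{≥0}`-valued degree on `Φ(L)`, e.g. abc-iut-L1's
`exists_nnreal_arithDegree`) factors UNIQUELY through the realification map, exactly as through
`Φ(L) → Φ(L)^rlf` (`IsPerfFactorial.Rlf.existsUnique_hom_extending`). ([IUTchI] Ex 3.5 (i) p.84)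
[claim: Mochizuki2012, status: disputed] -/
theorem realifyMod_existsUnique_monoidHom_extension
    (d : Multiplicative (EffArithDivisor L) →* Multiplicative ℝ≥0) :
    ∃! δ : Multiplicative (Val L →₀ ℝ≥0) →* Multiplicative ℝ≥0,
      δ.comp (AddMonoidHom.toMultiplicative (EffArithDivisor.realifyMod L)) = d := by
  obtain ⟨δ, hδ, huniq⟩ := realifyMod_existsUnique_extension L (MonoidHom.toAdditive d)
  refine ⟨AddMonoidHom.toMultiplicative δ, ?_, fun δ' hδ' => ?_⟩
  · apply MonoidHom.toAdditive.injective
    change δ.comp (EffArithDivisor.realifyMod L) = MonoidHom.toAdditive d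
    exact hδ
  · have h' : (MonoidHom.toAdditive δ').comp (EffArithDivisor.realifyMod L) = MonoidHom.toAdditive d := by
      rw [← hδ']
      rfl
    have := huniq (MonoidHom.toAdditive δ') h'
    apply MonoidHom.toAdditive.injective
    rw [this]
    rfl

end Literature.IUT.HodgeTheaters

end
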